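import Mathlib

/-!
# Real roots of the kernel interpolant of a positive matrix of divided-difference (Loewner) form
# (Connes–van Suijlekom 2025, §5: Lemma 5.2, Lemma 5.3, Theorem 5.6, Proposition 5.10)

Source, read verbatim (held text `paper:arxiv-2511.23257`): A. Connes, W. D. van Suijlekom,
*Quadratic Forms, Real Zeros and Echoes of the Spectral Action*, Comm. Math. Phys. **406** (2025),
doi:10.1007/s00220-025-05493-1 = arXiv:2511.23257 [bib: `ConnesSuijlekom2025`], Section 5
"Finite dimensional even case" and §5.1 "General finite dimensional operator `D`".

This is the FINITE-DIMENSIONAL theorem behind A. Connes, C. Consani, H. Moscovici, *Zeta spectral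
triples*, arXiv:2511.22755, Thm. 5.10 [bib: `ConnesConsaniMoscovici2025`] and A. Connes' 2026 letter,
arXiv:2602.04022, Thm. 6.1 [bib: `Connes2026Letter`] ("if the smallest eigenvalue of the truncated
Weil quadratic form `QW^N_λ` is simple with even eigenvector `ξ`, all zeros of `ξ̂` are real"): the
finite sections of those quadratic forms are matrices of the shape treated here (C–vS Prop. 4.1–4.2).
The tree already holds the CONTINUUM version of the mechanism for Weil's form on a window
(`Literature.NumberTheory.LFunctions.Connes2026_weilGroundState_zeros_re_eq_half_holds`, whose module
docstring records that "the finite-section architecture is not reproduced"); the present file supplies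
exactly that finite-dimensional architecture, as printed, for an abstract matrix.

## The printed statements (C–vS §5)

The data: an index set `{-N, …, N}`, real numbers `λ_j` (the simple spectrum of a self-adjoint `D`,
`D e_j = λ_j e_j`, with `λ_{-j} = -λ_j`; in Thm. 5.6 `λ_j = j`), real numbers `b_j` with `b_{-j} = -b_j`,
and a real symmetric positive (semi-definite) matrix `Q = (q_{ij})` "of the form (4.10)/(5.9)":
`q_{ij} = (b_i - b_j)/(λ_i - λ_j)` for `i ≠ j` (the diagonal is free). Write `γ e_j = e_{-j}`,
`β = Σ b_j e_j`, `η = Σ e_j`.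

* Lemma 5.1 (ii) / 5.7 (ii): `D Q - Q D = |β⟩⟨η| - |η⟩⟨β|` — in coordinates `(λ_i - λ_j) q_{ij} = b_i - b_j`
  (`commutator_of_dividedDifference`, and its action on vectors `commutator_apply`).
* Lemma 5.2 / 5.8: if `Q ≥ 0`, `Q ξ = 0`, `γ ξ = ξ`, `⟨ξ ∣ η⟩ = 1` then (i) `Q D ξ = -β` and (ii)
  `D' := D - |D ξ⟩⟨η|` is self-adjoint for `⟨· ∣ ·⟩_Q`, i.e. `⟨x ∣ Q D' y⟩ = ⟨D' x ∣ Q y⟩`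
  (`mulVec_D_kernel`, `dPrime_adjoint`).
* Lemma 5.3 / 5.9: the determinant formula (5.5)
  `Det(D' - s) = -s Π_i(λ_i - s) Σ_j ξ_j/(λ_j - s)` off the spectrum (`det_dPrimeMatrix_sub`, by the matrix
  determinant lemma), (i) `Det(D' - s) = 0 ⟺ Σ_j ξ_j/(s - λ_j) = 0` (`det_dPrimeMatrix_sub_eq_zero_iff`),
  (ii) `Det(D') = 0` and `Det(D' - λ_j) = 0 ⟺ ξ_j = 0` (`det_dPrimeMatrix_eq_zero`,
  `det_dPrimeMatrix_sub_eigenvalue_eq_zero_iff`); and the eigenvector behind (5.5) used in the proof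
  of Thm. 5.6 below: if `Σ_j ξ_j/(λ_j - μ) = 0` then `v_j = λ_j ξ_j/(λ_j - μ)` satisfies `D' v = μ v`,
  `v ≠ 0` (`dPrime_eigenvector`).
* Theorem 5.6 (i) / Proposition 5.10: if moreover the kernel of `Q` is ONE-dimensional and even, all
  roots of `P(s) = Σ_k ξ_k Π_{j ≠ k} (λ_j - s)` are real (`im_eq_zero_of_even_kernel`, index set with an
  involution; `im_eq_zero_of_even_kernel_int` and `…_Icc` for `λ_j = j` on a symmetric set of integers,
  resp. literally on `{-N, …, N}`).
* Theorem 5.6 (ii): the Fourier transform `ξ̂(z) = ∫_0^1 ξ(x) e^{-izx} dx` of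
  `ξ(x) = Σ_k ξ_k e^{2πikx}` (on `[0,1]`, zero outside) has all its zeros on the real line
  (`fourierIntegral_eq_zero_im_eq_zero`; on a window `[0, L]` with frequencies `2πk/L`, as used in
  Connes–Consani–Moscovici Thm. 5.10 (iii) with `L = 2 log λ`: `fourierIntegral_eq_zero_im_eq_zero_of_length`).

## The proof given here vs. the printed proof

C–vS prove Thm. 5.6 (i) by passing to the separated quotient `E = (ℝ^{2N+1}, Q)/ℝξ`, on which `D'`
descends to a self-adjoint operator `D''` (Lemma 5.2 (ii)), invoking the real spectral theorem for
`D''`, and comparing `Det(D' - s) = -s Π(λ_j - s)` with the determinant formula (5.5) of Lemma 5.3.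
We keep Lemma 5.2 verbatim and replace "quotient + spectral theorem + determinant" by the same
mechanism in coordinates (shorter in Mathlib, no new ideas): a root `μ ∉ {λ_j} ∪ {0}` of `P` yields the
explicit complex eigenvector `v` of `D'` above; pairing `D' v = μ v` against `conj v` through `Q` and using
Lemma 5.2 (ii) gives `(μ - conj μ) ⟨conj v ∣ Q v⟩ = 0`; if `⟨conj v ∣ Q v⟩ = 0` then `Q ≥ 0` forces the real
and imaginary parts of `v` into `ker Q = ℝ ξ`, whence `v = ξ`, `D' v = 0`, `μ = 0` — excluded. Roots
`μ ∈ {λ_j} ∪ {0}` are real outright. As in the paper (proof of Thm. 5.6: "one can normalize `ξ` so that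
`⟨η ∣ ξ⟩ = 1`" because `D ξ` is odd, hence `∉ ℝξ ∖ 0`), evenness of `ξ`, oddness of `λ, b` and simplicity of
the spectrum are used exactly once, to get `⟨β ∣ ξ⟩ = 0` and `⟨η ∣ ξ⟩ ≠ 0`; the core statement
`im_eq_zero_of_kernelInterpolant_eq_zero` isolates what is used afterwards.
For Thm. 5.6 (ii) we follow the printed computation
`∫_0^1 e^{2πikx} e^{-izx} dx = (e^{-iz} - 1)/(i(2πk - z))`, so that off the lattice `2πℤ` the zeros of `ξ̂`
are `e^{-iz} = 1` (real) or `Σ_k ξ_k/(2πk - z) = 0`, i.e. roots of `P(z/2π)`; lattice points are real anyway.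

Deliberately NOT here: that `ξ̂` is entire (not needed for the location of its zeros; the tree's
`weilMellin` files prove holomorphy in their setting); the infinite-dimensional Thm. 6.1 / 1.2 (Hurwitz) —
see the `WeilGroundStateRealZeros*` files; the Toeplitz Corollary 1.1 (Carathéodory–Fejér) — see
`Literature/LinearAlgebra/Matrix/ToeplitzKernelRootsUnitCircle.lean`; any statement about Weil's
quadratic form, `ζ`, or RH.
-/

open Finset Matrix Complex MeasureTheory

open scoped ComplexConjugate Real

namespace Literature.LinearAlgebra.Matrix

namespace ConnesVanSuijlekom

variable {ι : Type*} [Fintype ι]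

/-! ## Lemma 5.1 / 5.7: the commutation relation of a divided-difference matrix -/

omit [Fintype ι] in
/-- **C–vS Lemma 5.1 (ii) / Lemma 5.7 (ii) in coordinates.** If `q_{ij} = (b_i - b_j)/(λ_i - λ_j)` off the
diagonal and the `λ_i` are pairwise distinct ("`D` has simple spectrum"), then
`(λ_i - λ_j) q_{ij} = b_i - b_j` for ALL `i, j`, i.e. `D Q - Q D = |β⟩⟨η| - |η⟩⟨β|` with `β = Σ b_j e_j`,
`η = Σ e_j`. [cite: ConnesSuijlekom2025, Lemma 5.1 (ii) and Lemma 5.7 (ii)] -/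
theorem commutator_of_dividedDifference {K : Type*} [Field K] {lam b : ι → K} {Q : Matrix ι ι K}
    (hlam : Function.Injective lam) (hQoff : ∀ i j, i ≠ j → Q i j = (b i - b j) / (lam i - lam j)) :
    ∀ i j, (lam i - lam j) * Q i j = b i - b j := by
  intro i j
  by_cases hij : i = j
  · subst hij; simp
  · rw [hQoff i j hij, mul_div_cancel₀ _ (sub_ne_zero.mpr (hlam.ne hij))]

/-- The commutation relation applied to a vector: `(Q D y)_i = λ_i (Q y)_i - b_i ⟨η ∣ y⟩ + ⟨β ∣ y⟩`, i.e.
`Q D = D Q - |β⟩⟨η| + |η⟩⟨β|`. [cite: ConnesSuijlekom2025, Lemma 5.1 (ii), eq. (5.2)] -/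
theorem commutator_apply {K : Type*} [CommRing K] {lam b : ι → K} {Q : Matrix ι ι K}
    (hcomm : ∀ i j, (lam i - lam j) * Q i j = b i - b j) (y : ι → K) (i : ι) :
    ∑ j, Q i j * (lam j * y j) = lam i * ∑ j, Q i j * y j - b i * ∑ j, y j + ∑ j, b j * y j := by
  calc ∑ j, Q i j * (lam j * y j)
      = ∑ j, (lam i * (Q i j * y j) - b i * y j + b j * y j) := by
        refine sum_congr rfl fun j _ => ?_
        linear_combination (-(y j)) * hcomm i j
    _ = lam i * ∑ j, Q i j * y j - b i * ∑ j, y j + ∑ j, b j * y j := by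
        rw [sum_add_distrib, sum_sub_distrib, mul_sum, mul_sum]

/-! ## Lemma 5.2 / 5.8: `Q D ξ = -β` and `Q`-self-adjointness of `D' = D - |Dξ⟩⟨η|` -/

/-- **C–vS Lemma 5.2 (i) / 5.8 (i).** If `Q ξ = 0`, `⟨β ∣ ξ⟩ = 0` and `⟨η ∣ ξ⟩ = 1` then `Q D ξ = -β`:
`Σ_j q_{ij} λ_j ξ_j = -b_i`. [cite: ConnesSuijlekom2025, Lemma 5.2 (i)] -/
theorem mulVec_D_kernel {K : Type*} [CommRing K] {lam b ξ : ι → K} {Q : Matrix ι ι K}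
    (hcomm : ∀ i j, (lam i - lam j) * Q i j = b i - b j) (hQξ : ∀ i, ∑ j, Q i j * ξ j = 0)
    (hbξ : ∑ j, b j * ξ j = 0) (hηξ : ∑ j, ξ j = 1) (i : ι) :
    ∑ j, Q i j * (lam j * ξ j) = -b i := by
  rw [commutator_apply hcomm ξ i, hQξ i, hbξ, hηξ]; ring

/-- **C–vS Lemma 5.2 (ii) / 5.8 (ii).** With `D' y := D y - (D ξ) ⟨η ∣ y⟩`, under the hypotheses of
Lemma 5.2 (i) and symmetry of `Q`: `Q (D' y) = D (Q y) + ⟨β ∣ y⟩ η` for every `y`, hence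
`⟨x ∣ Q D' y⟩ = ⟨D' x ∣ Q y⟩` for all `x, y` — "the operator `D'` is selfadjoint with respect to the inner
product defined by `Q`" (bilinear version, no conjugation; vectors with entries in any commutative ring).
[cite: ConnesSuijlekom2025, Lemma 5.2 (ii)] -/
theorem dPrime_adjoint {K : Type*} [CommRing K] {lam b ξ : ι → K} {Q : Matrix ι ι K}
    (hsymm : ∀ i j, Q j i = Q i j)
    (hcomm : ∀ i j, (lam i - lam j) * Q i j = b i - b j) (hQξ : ∀ i, ∑ j, Q i j * ξ j = 0)
    (hbξ : ∑ j, b j * ξ j = 0) (hηξ : ∑ j, ξ j = 1)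
    (Dp : (ι → K) → (ι → K)) (hDp : ∀ y k, Dp y k = lam k * y k - lam k * ξ k * ∑ j, y j)
    (x y : ι → K) :
    ∑ i, x i * ∑ j, Q i j * Dp y j = ∑ i, Dp x i * ∑ j, Q i j * y j := by
  have hL1 : ∀ i, ∑ j, Q i j * (lam j * ξ j) = -b i := mulVec_D_kernel hcomm hQξ hbξ hηξ
  -- `Q (D' y) = D (Q y) + ⟨β ∣ y⟩ η`
  have hQDp : ∀ i, ∑ j, Q i j * Dp y j = lam i * ∑ j, Q i j * y j + ∑ j, b j * y j := by
    intro i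
    have h1 : ∀ j, Q i j * Dp y j
        = lam i * (Q i j * y j) - b i * y j + b j * y j - Q i j * (lam j * ξ j) * ∑ l, y l := by
      intro j; rw [hDp]; linear_combination (-(y j)) * hcomm i j
    rw [sum_congr rfl fun j _ => h1 j]
    simp only [sum_sub_distrib, sum_add_distrib, ← mul_sum, ← sum_mul]
    rw [hL1 i]; ring
  -- `⟨D ξ ∣ Q y⟩ = -⟨β ∣ y⟩`
  have hL2 : ∑ i, (lam i * ξ i) * ∑ j, Q i j * y j = -∑ j, b j * y j := by
    calc ∑ i, (lam i * ξ i) * ∑ j, Q i j * y j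
        = ∑ i, ∑ j, (lam i * ξ i) * (Q i j * y j) := by simp_rw [mul_sum]
      _ = ∑ j, ∑ i, (lam i * ξ i) * (Q i j * y j) := sum_comm
      _ = ∑ j, y j * ∑ i, Q j i * (lam i * ξ i) := by
          refine sum_congr rfl fun j _ => ?_
          rw [mul_sum]
          refine sum_congr rfl fun i _ => ?_
          rw [hsymm j i]; ring
      _ = -∑ j, b j * y j := by
          rw [← sum_neg_distrib]
          refine sum_congr rfl fun j _ => ?_
          rw [hL1 j]; ring
  have lhs : ∑ i, x i * ∑ j, Q i j * Dp y j
      = ∑ i, lam i * x i * ∑ j, Q i j * y j + (∑ i, x i) * ∑ j, b j * y j := by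
    rw [sum_mul, ← sum_add_distrib]
    refine sum_congr rfl fun i _ => ?_
    rw [hQDp i]; ring
  have rhs : ∑ i, Dp x i * ∑ j, Q i j * y j
      = ∑ i, lam i * x i * ∑ j, Q i j * y j + (∑ i, x i) * ∑ j, b j * y j := by
    have h3 : ∀ i, Dp x i * ∑ j, Q i j * y j
        = lam i * x i * ∑ j, Q i j * y j - (∑ l, x l) * ((lam i * ξ i) * ∑ j, Q i j * y j) := by
      intro i; rw [hDp]; ring
    rw [sum_congr rfl fun i _ => h3 i, sum_sub_distrib, ← mul_sum, hL2]
    ring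
  rw [lhs, rhs]

/-! ## Lemma 5.3 / 5.9: roots of `P` off the spectrum are eigenvalues of `D'` -/

/-- **C–vS Lemma 5.3 (i) / 5.9 (i), eigenvector form.** Let `⟨η ∣ ξ⟩ = Σ ξ_j = 1` and let
`μ ∉ {λ_j} ∪ {0}` satisfy `Σ_j ξ_j/(λ_j - μ) = 0` (equivalently, (5.5): `Det(D' - μ) = 0`). Then
`v_j := λ_j ξ_j/(λ_j - μ)` is a non-zero vector with `⟨η ∣ v⟩ = 1` and `D' v = μ v`, where
`D' y = D y - (D ξ)⟨η ∣ y⟩`. (The paper argues with `Det(D' - s) = -s Det(D - s) ⟨η ∣ (D - s)⁻¹ ξ⟩`; the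
vector `v = (D - μ)⁻¹ D ξ` is the corresponding eigenvector.) [cite: ConnesSuijlekom2025, Lemma 5.3 (i) and eq. (5.5)] -/
theorem dPrime_eigenvector {K : Type*} [Field K] {lam ξ : ι → K} (hηξ : ∑ j, ξ j = 1) {μ : K}
    (hμ0 : μ ≠ 0) (hne : ∀ j, lam j - μ ≠ 0) (hS0 : ∑ k, ξ k / (lam k - μ) = 0)
    (v : ι → K) (hv : ∀ k, v k = lam k * ξ k / (lam k - μ)) :
    v ≠ 0 ∧ ∑ k, v k = 1 ∧ ∀ k, lam k * v k - lam k * ξ k * ∑ j, v j = μ * v k := by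
  have hvsum : ∑ k, v k = 1 := by
    calc ∑ k, v k = ∑ k, (ξ k + μ * (ξ k / (lam k - μ))) := by
          refine sum_congr rfl fun k _ => ?_
          rw [hv k]; field_simp [hne k]; ring
      _ = ∑ k, ξ k + μ * ∑ k, ξ k / (lam k - μ) := by rw [sum_add_distrib, mul_sum]
      _ = 1 := by rw [hηξ, hS0, mul_zero, add_zero]
  refine ⟨?_, hvsum, ?_⟩
  · intro h0
    have hk : ∀ k, lam k * ξ k = 0 := fun k => by
      have h := congr_fun h0 k
      rw [hv k, Pi.zero_apply, div_eq_zero_iff] at h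
      exact h.resolve_right (hne k)
    have hterm : ∀ k, ξ k / (lam k - μ) = ξ k / (-μ) := fun k => by
      rcases mul_eq_zero.mp (hk k) with h | h
      · rw [h, zero_sub]
      · rw [h, zero_div, zero_div]
    have h1 : ∑ k, ξ k / (lam k - μ) = -(1 / μ) := by
      rw [sum_congr rfl fun k _ => hterm k, ← sum_div, hηξ, div_neg]
    rw [hS0] at h1
    have h2 : (1 : K) / μ = 0 := by linear_combination h1
    rw [one_div, inv_eq_zero] at h2
    exact hμ0 h2
  · intro k
    rw [hvsum, mul_one, hv k]
    field_simp [hne k]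
    ring

/-! ## Theorem 5.6 (i) / Proposition 5.10 -/

/-- **Core of C–vS Thm. 5.6 (i) / Prop. 5.10** (what the printed proof uses after the normalisation
`⟨η ∣ ξ⟩ = 1`). Let `Q` be a real positive semi-definite matrix with `(λ_i - λ_j) q_{ij} = b_i - b_j`
(Lemma 5.1), let `ξ` span `ker Q`, `⟨β ∣ ξ⟩ = Σ b_i ξ_i = 0` and `⟨η ∣ ξ⟩ = Σ ξ_i = 1`. Then every complex
root `μ` of `P(s) = Σ_k ξ_k Π_{j ≠ k} (λ_j - s)` is real. [cite: ConnesSuijlekom2025, Theorem 5.6 (i) (proof) and Proposition 5.10] -/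
theorem im_eq_zero_of_kernelInterpolant_eq_zero [DecidableEq ι]
    {Q : Matrix ι ι ℝ} (hQ : Q.PosSemidef) {lam b ξ : ι → ℝ}
    (hcomm : ∀ i j, (lam i - lam j) * Q i j = b i - b j)
    (hQξ : Q *ᵥ ξ = 0) (hker : ∀ v : ι → ℝ, Q *ᵥ v = 0 → ∃ c : ℝ, v = c • ξ)
    (hbξ : ∑ i, b i * ξ i = 0) (hηξ : ∑ i, ξ i = 1)
    {μ : ℂ} (hP : ∑ k, (ξ k : ℂ) * ∏ j ∈ univ.erase k, ((lam j : ℂ) - μ) = 0) :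
    μ.im = 0 := by
  by_contra hμ
  -- (0) symmetry of `Q`; the hypotheses read in `ℂ`
  have hsymm : ∀ i j, Q j i = Q i j := fun i j => by simpa using hQ.1.apply i j
  have hsymmC : ∀ i j, ((Q j i : ℝ) : ℂ) = ((Q i j : ℝ) : ℂ) := fun i j => by rw [hsymm i j]
  have hcommC : ∀ i j, ((lam i : ℂ) - (lam j : ℂ)) * ((Q i j : ℝ) : ℂ) = (b i : ℂ) - (b j : ℂ) :=
    fun i j => by exact_mod_cast hcomm i j
  have hQξC : ∀ i, ∑ j, ((Q i j : ℝ) : ℂ) * (ξ j : ℂ) = 0 := fun i => by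
    have h := congr_fun hQξ i
    simp only [mulVec, dotProduct, Pi.zero_apply] at h
    exact_mod_cast h
  have hbξC : ∑ i, (b i : ℂ) * (ξ i : ℂ) = 0 := by exact_mod_cast hbξ
  have hξC : ∑ i, (ξ i : ℂ) = 1 := by exact_mod_cast hηξ
  -- `μ` is neither `0` nor one of the real numbers `λ_j`
  have hμ0 : μ ≠ 0 := by
    rintro rfl
    exact hμ Complex.zero_im
  have hne : ∀ j, (lam j : ℂ) - μ ≠ 0 := by
    intro j h
    apply hμ
    rw [← sub_eq_zero.mp h]
    exact Complex.ofReal_im _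
  have hprod : ∏ j, ((lam j : ℂ) - μ) ≠ 0 := prod_ne_zero_iff.mpr fun j _ => hne j
  -- (1) Lemma 5.3: `Σ_k ξ_k/(λ_k - μ) = 0`
  have hS0 : ∑ k, (ξ k : ℂ) / ((lam k : ℂ) - μ) = 0 := by
    have h : (∏ j, ((lam j : ℂ) - μ)) * ∑ k, (ξ k : ℂ) / ((lam k : ℂ) - μ)
        = ∑ k, (ξ k : ℂ) * ∏ j ∈ univ.erase k, ((lam j : ℂ) - μ) := by
      rw [mul_sum]
      refine sum_congr rfl fun k _ => ?_
      rw [← mul_prod_erase univ (fun j => ((lam j : ℂ) - μ)) (mem_univ k)]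
      field_simp [hne k]
    rw [hP] at h
    exact (mul_eq_zero.mp h).resolve_left hprod
  -- (2) the eigenvector `v` of `D' = D - |Dξ⟩⟨η|` for `μ`
  obtain ⟨v, hv⟩ : ∃ v : ι → ℂ, ∀ k, v k = (lam k : ℂ) * (ξ k : ℂ) / ((lam k : ℂ) - μ) :=
    ⟨fun k => (lam k : ℂ) * (ξ k : ℂ) / ((lam k : ℂ) - μ), fun _ => rfl⟩
  obtain ⟨hv0, hvsum, heig⟩ :=
    dPrime_eigenvector (lam := fun k => (lam k : ℂ)) (ξ := fun k => (ξ k : ℂ)) hξC hμ0 hne hS0 v hv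
  obtain ⟨Dp, hDp⟩ : ∃ Dp : (ι → ℂ) → (ι → ℂ),
      ∀ y k, Dp y k = (lam k : ℂ) * y k - (lam k : ℂ) * (ξ k : ℂ) * ∑ j, y j :=
    ⟨fun y k => (lam k : ℂ) * y k - (lam k : ℂ) * (ξ k : ℂ) * ∑ j, y j, fun _ _ => rfl⟩
  have hDv : ∀ k, Dp v k = μ * v k := fun k => by rw [hDp]; exact heig k
  have hDsv : ∀ k, Dp (star v) k = conj μ * star v k := by
    intro k
    have h := congrArg conj (heig k)
    simp only [map_sub, map_mul, Complex.conj_ofReal, map_sum] at h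
    rw [hDp]
    simpa [Pi.star_apply] using h
  -- (3) Lemma 5.2 (ii) with `x = conj v`, `y = v`: `(μ - conj μ) ⟨conj v ∣ Q v⟩ = 0`
  have hadj := dPrime_adjoint (Q := fun i j => ((Q i j : ℝ) : ℂ)) hsymmC hcommC hQξC hbξC hξC Dp hDp
    (star v) v
  have hμq : (μ - conj μ) * ∑ i, star v i * ∑ j, ((Q i j : ℝ) : ℂ) * v j = 0 := by
    have hl : ∑ i, star v i * ∑ j, ((Q i j : ℝ) : ℂ) * Dp v j
        = μ * ∑ i, star v i * ∑ j, ((Q i j : ℝ) : ℂ) * v j := by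
      rw [mul_sum]
      refine sum_congr rfl fun i _ => ?_
      rw [sum_congr rfl fun j _ => by rw [hDv j], show ∑ j, ((Q i j : ℝ) : ℂ) * (μ * v j)
        = μ * ∑ j, ((Q i j : ℝ) : ℂ) * v j by rw [mul_sum]; exact sum_congr rfl fun j _ => by ring]
      ring
    have hr : ∑ i, Dp (star v) i * ∑ j, ((Q i j : ℝ) : ℂ) * v j
        = conj μ * ∑ i, star v i * ∑ j, ((Q i j : ℝ) : ℂ) * v j := by
      rw [mul_sum]
      refine sum_congr rfl fun i _ => ?_
      rw [hDsv i]; ring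
    rw [hl, hr] at hadj
    linear_combination hadj
  rcases mul_eq_zero.mp hμq with h | hq
  · exact hμ (Complex.conj_eq_iff_im.mp (sub_eq_zero.mp h).symm)
  -- (4) `⟨conj v ∣ Q v⟩ = 0`: real and imaginary parts of `v` lie in `ker Q = ℝ ξ`, so `v = ξ`, `μ = 0`
  obtain ⟨a, ha⟩ : ∃ a : ι → ℝ, ∀ k, a k = (v k).re := ⟨fun k => (v k).re, fun _ => rfl⟩
  obtain ⟨c, hc⟩ : ∃ c : ι → ℝ, ∀ k, c k = (v k).im := ⟨fun k => (v k).im, fun _ => rfl⟩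
  have hw_re : ∀ i, (∑ j, ((Q i j : ℝ) : ℂ) * v j).re = ∑ j, Q i j * a j := fun i => by
    rw [Complex.re_sum]
    exact sum_congr rfl fun j _ => by rw [Complex.re_ofReal_mul, ha]
  have hw_im : ∀ i, (∑ j, ((Q i j : ℝ) : ℂ) * v j).im = ∑ j, Q i j * c j := fun i => by
    rw [Complex.im_sum]
    exact sum_congr rfl fun j _ => by rw [Complex.im_ofReal_mul, hc]
  have hqre : (∑ i, star v i * ∑ j, ((Q i j : ℝ) : ℂ) * v j).re = a ⬝ᵥ (Q *ᵥ a) + c ⬝ᵥ (Q *ᵥ c) := by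
    rw [Complex.re_sum]
    simp only [dotProduct, mulVec, ← sum_add_distrib]
    refine sum_congr rfl fun i _ => ?_
    rw [Complex.mul_re, hw_re, hw_im, Pi.star_apply, Complex.star_def, Complex.conj_re,
      Complex.conj_im, ← ha i, ← hc i]
    ring
  have hsum0 : a ⬝ᵥ (Q *ᵥ a) + c ⬝ᵥ (Q *ᵥ c) = 0 := by rw [← hqre, hq, Complex.zero_re]
  have ha0 : 0 ≤ a ⬝ᵥ (Q *ᵥ a) := by simpa using hQ.dotProduct_mulVec_nonneg a
  have hc0 : 0 ≤ c ⬝ᵥ (Q *ᵥ c) := by simpa using hQ.dotProduct_mulVec_nonneg c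
  have hQa : Q *ᵥ a = 0 :=
    (hQ.dotProduct_mulVec_zero_iff a).mp (by simpa using (by linarith : a ⬝ᵥ (Q *ᵥ a) = 0))
  have hQc : Q *ᵥ c = 0 :=
    (hQ.dotProduct_mulVec_zero_iff c).mp (by simpa using (by linarith : c ⬝ᵥ (Q *ᵥ c) = 0))
  obtain ⟨α, hα⟩ := hker a hQa
  obtain ⟨β, hβ⟩ := hker c hQc
  have hvξ : ∀ k, v k = ((α : ℂ) + (β : ℂ) * I) * (ξ k : ℂ) := by
    intro k
    have h1 : (v k).re = α * ξ k := by rw [← ha k, hα, Pi.smul_apply, smul_eq_mul]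
    have h2 : (v k).im = β * ξ k := by rw [← hc k, hβ, Pi.smul_apply, smul_eq_mul]
    apply Complex.ext <;> simp [h1, h2]
  have hγ : (α : ℂ) + (β : ℂ) * I = 1 := by
    have h := hvsum
    rw [sum_congr rfl fun k _ => hvξ k, ← mul_sum, hξC, mul_one] at h
    exact h
  have hvξ' : ∀ k, v k = (ξ k : ℂ) := fun k => by rw [hvξ k, hγ, one_mul]
  have hμv : ∀ k, μ * (ξ k : ℂ) = 0 := fun k => by
    have h := heig k
    rw [hvsum, hvξ' k] at h
    linear_combination -h
  have hμ' : μ = 0 := by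
    have h : μ * ∑ k, (ξ k : ℂ) = 0 := by
      rw [mul_sum]
      exact sum_eq_zero fun k _ => hμv k
    rwa [hξC, mul_one] at h
  exact hμ0 hμ'

/-- **C–vS Proposition 5.10 (= Theorem 5.6 (i) for a general diagonal `D` with simple odd spectrum).**
Index set `ι` with the reflection `σ` (printed: `ι = {-N, …, N}`, `σ i = -i`), real `λ` injective with
`λ_{σ i} = -λ_i`, real `b` with `b_{σ i} = -b_i`, and a real symmetric positive matrix `Q` with
`q_{ij} = (b_i - b_j)/(λ_i - λ_j)` for `i ≠ j` whose kernel is one-dimensional, spanned by an EVEN vector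
`ξ` (`ξ_{σ i} = ξ_i`, `ξ ≠ 0`). Then all roots of `P(s) = Σ_k ξ_k Π_{j ≠ k}(λ_j - s)` are real: every
`μ : ℂ` with `P(μ) = 0` has `Im μ = 0`. (The printed hypotheses also fix the diagonal `q_{ii} = a_i` with
`a_{-i} = a_i`; this is not used.) [cite: ConnesSuijlekom2025, Proposition 5.10] -/
theorem im_eq_zero_of_even_kernel [DecidableEq ι]
    {σ : ι → ι} (hσ : Function.Involutive σ)
    {lam b ξ : ι → ℝ} {Q : Matrix ι ι ℝ}
    (hlam : Function.Injective lam) (hlamσ : ∀ i, lam (σ i) = -lam i) (hbσ : ∀ i, b (σ i) = -b i)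
    (hQoff : ∀ i j, i ≠ j → Q i j = (b i - b j) / (lam i - lam j))
    (hQ : Q.PosSemidef) (hξ0 : ξ ≠ 0) (hQξ : Q *ᵥ ξ = 0)
    (hker : ∀ v : ι → ℝ, Q *ᵥ v = 0 → ∃ c : ℝ, v = c • ξ) (hξσ : ∀ i, ξ (σ i) = ξ i)
    {μ : ℂ} (hP : ∑ k, (ξ k : ℂ) * ∏ j ∈ univ.erase k, ((lam j : ℂ) - μ) = 0) :
    μ.im = 0 := by
  -- Lemma 5.7 (ii): the commutation relation
  have hcomm : ∀ i j, (lam i - lam j) * Q i j = b i - b j := commutator_of_dividedDifference hlam hQoff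
  -- `⟨β ∣ ξ⟩ = 0`: `β` is odd and `ξ` is even ("the two eigenspaces of `γ` are orthogonal")
  have hbξ : ∑ i, b i * ξ i = 0 := by
    have h : ∑ i, b (σ i) * ξ (σ i) = ∑ i, b i * ξ i :=
      Fintype.sum_bijective σ hσ.bijective (fun i => b (σ i) * ξ (σ i)) (fun i => b i * ξ i)
        fun _ => rfl
    simp only [hbσ, hξσ, neg_mul, sum_neg_distrib] at h
    linarith
  have hQξ' : ∀ i, ∑ j, Q i j * ξ j = 0 := fun i => by
    have h := congr_fun hQξ i
    simpa [mulVec, dotProduct] using h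
  -- `⟨η ∣ ξ⟩ ≠ 0` ("`D ξ` is odd and therefore linearly independent of `ξ` while `ker Q` is one-dimensional")
  have hc : ∑ i, ξ i ≠ 0 := by
    intro hc
    have hQD : Q *ᵥ (fun j => lam j * ξ j) = 0 := by
      funext i
      simp only [mulVec, dotProduct, Pi.zero_apply]
      rw [commutator_apply hcomm ξ i, hQξ' i, hc, hbξ]
      ring
    obtain ⟨d, hd⟩ := hker _ hQD
    have hDξ : ∀ k, lam k * ξ k = 0 := by
      intro k
      have h1 : lam k * ξ k = d * ξ k := by simpa using congr_fun hd k
      have h2 : lam (σ k) * ξ (σ k) = d * ξ (σ k) := by simpa using congr_fun hd (σ k)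
      rw [hlamσ, hξσ] at h2
      linarith
    obtain ⟨k₀, hk₀⟩ : ∃ k, ξ k ≠ 0 := by
      by_contra h
      push Not at h
      exact hξ0 (funext h)
    have hlam₀ : lam k₀ = 0 := (mul_eq_zero.mp (hDξ k₀)).resolve_right hk₀
    have hsupp : ∀ k, k ≠ k₀ → ξ k = 0 := by
      intro k hk
      by_contra hξk
      have h : lam k = 0 := (mul_eq_zero.mp (hDξ k)).resolve_right hξk
      exact hk (hlam (h.trans hlam₀.symm))
    have hsum : ∑ i, ξ i = ξ k₀ := by
      rw [sum_eq_single k₀ (fun k _ hk => hsupp k hk) (fun h => absurd (mem_univ k₀) h)]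
    exact hk₀ (hsum.symm.trans hc)
  -- normalise to `⟨η ∣ ξ⟩ = 1` and apply the core statement to `ξ / ⟨η ∣ ξ⟩`
  refine im_eq_zero_of_kernelInterpolant_eq_zero (ξ := fun k => ξ k / ∑ i, ξ i) (μ := μ) hQ hcomm
    ?_ ?_ ?_ ?_ ?_
  · have h : (fun k => ξ k / ∑ i, ξ i) = (∑ i, ξ i)⁻¹ • ξ := by
      funext k; simp [div_eq_inv_mul]
    rw [h, mulVec_smul, hQξ, smul_zero]
  · intro v hv
    obtain ⟨d, hd⟩ := hker v hv
    refine ⟨d * ∑ i, ξ i, ?_⟩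
    funext k
    rw [hd, Pi.smul_apply, Pi.smul_apply, smul_eq_mul, smul_eq_mul]
    field_simp
  · have h : ∑ i, b i * (ξ i / ∑ l, ξ l) = (∑ i, b i * ξ i) / ∑ l, ξ l := by
      rw [sum_div]
      exact sum_congr rfl fun i _ => by ring
    rw [h, hbξ, zero_div]
  · rw [← sum_div, div_self hc]
  · have h : ∑ k, ((ξ k / ∑ i, ξ i : ℝ) : ℂ) * ∏ j ∈ univ.erase k, ((lam j : ℂ) - μ)
        = (∑ k, (ξ k : ℂ) * ∏ j ∈ univ.erase k, ((lam j : ℂ) - μ)) / ((∑ i, ξ i : ℝ) : ℂ) := by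
      rw [sum_div]
      refine sum_congr rfl fun k _ => ?_
      push_cast
      ring
    rw [h, hP, zero_div]

/-- **C–vS Theorem 5.6 (i)** (`λ_j = j`), for any finite set `S ⊂ ℤ` of indices symmetric under
`j ↦ -j` (printed: `S = {-N, …, N}`): if `Q` is a real symmetric positive matrix on `S` with
`q_{ij} = (b_i - b_j)/(i - j)` for `i ≠ j`, `b_{-i} = -b_i`, whose kernel is one-dimensional and spanned by
an even vector `ξ` (`ξ_{-i} = ξ_i`), then all roots of `P(s) = Σ_{k ∈ S} ξ_k Π_{j ∈ S, j ≠ k} (j - s)` are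
real. [cite: ConnesSuijlekom2025, Theorem 5.6 (i)] -/
theorem im_eq_zero_of_even_kernel_int (S : Finset ℤ) (hS : ∀ j ∈ S, -j ∈ S)
    {b ξ : S → ℝ} {Q : Matrix S S ℝ}
    (hb : ∀ i j : S, (i : ℤ) = -(j : ℤ) → b i = -b j)
    (hQoff : ∀ i j : S, i ≠ j → Q i j = (b i - b j) / (((i : ℤ) : ℝ) - ((j : ℤ) : ℝ)))
    (hQ : Q.PosSemidef) (hξ0 : ξ ≠ 0) (hQξ : Q *ᵥ ξ = 0)
    (hker : ∀ v : S → ℝ, Q *ᵥ v = 0 → ∃ c : ℝ, v = c • ξ)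
    (hξ : ∀ i j : S, (i : ℤ) = -(j : ℤ) → ξ i = ξ j)
    {μ : ℂ} (hP : ∑ k : S, (ξ k : ℂ) * ∏ j ∈ univ.erase k, (((j : ℤ) : ℂ) - μ) = 0) :
    μ.im = 0 := by
  -- the reflection `j ↦ -j` of the index set
  obtain ⟨σ, hσv⟩ : ∃ σ : S → S, ∀ j : S, ((σ j : S) : ℤ) = -(j : ℤ) :=
    ⟨fun j => ⟨-(j : ℤ), hS j j.2⟩, fun _ => rfl⟩
  have hσ : Function.Involutive σ := fun j => Subtype.ext (by rw [hσv, hσv, neg_neg])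
  refine im_eq_zero_of_even_kernel (lam := fun j : S => ((j : ℤ) : ℝ)) hσ ?_ ?_ ?_ hQoff hQ hξ0 hQξ
    hker ?_ ?_
  · intro i j h
    have h' : ((i : ℤ) : ℝ) = ((j : ℤ) : ℝ) := h
    exact Subtype.ext (by exact_mod_cast h')
  · intro i
    simp [hσv]
  · intro i
    exact hb (σ i) i (hσv i)
  · intro i
    exact hξ (σ i) i (hσv i)
  · simpa using hP

/-- **C–vS Theorem 5.6 (i), literally on `{-N, …, N}`.** [cite: ConnesSuijlekom2025, Theorem 5.6 (i)] -/
theorem im_eq_zero_of_even_kernel_Icc (N : ℕ)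
    {b ξ : (Finset.Icc (-(N : ℤ)) N) → ℝ}
    {Q : Matrix (Finset.Icc (-(N : ℤ)) N) (Finset.Icc (-(N : ℤ)) N) ℝ}
    (hb : ∀ i j : (Finset.Icc (-(N : ℤ)) N), (i : ℤ) = -(j : ℤ) → b i = -b j)
    (hQoff : ∀ i j : (Finset.Icc (-(N : ℤ)) N), i ≠ j →
      Q i j = (b i - b j) / (((i : ℤ) : ℝ) - ((j : ℤ) : ℝ)))
    (hQ : Q.PosSemidef) (hξ0 : ξ ≠ 0) (hQξ : Q *ᵥ ξ = 0)
    (hker : ∀ v : (Finset.Icc (-(N : ℤ)) N) → ℝ, Q *ᵥ v = 0 → ∃ c : ℝ, v = c • ξ)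
    (hξ : ∀ i j : (Finset.Icc (-(N : ℤ)) N), (i : ℤ) = -(j : ℤ) → ξ i = ξ j)
    {μ : ℂ} (hP : ∑ k : (Finset.Icc (-(N : ℤ)) N),
      (ξ k : ℂ) * ∏ j ∈ univ.erase k, (((j : ℤ) : ℂ) - μ) = 0) :
    μ.im = 0 :=
  im_eq_zero_of_even_kernel_int (Finset.Icc (-(N : ℤ)) N)
    (fun j hj => by simp only [Finset.mem_Icc] at hj ⊢; omega) hb hQoff hQ hξ0 hQξ hker hξ hP

/-! ## Theorem 5.6 (ii): zeros of the Fourier transform of `ξ(x) = Σ ξ_k e^{2πikx}` on `[0,1]` -/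

/-- **C–vS Theorem 5.6 (ii).** Under the hypotheses of Theorem 5.6 (i) (on a symmetric finite set
`S ⊂ ℤ` of frequencies; printed: `S = {-N, …, N}`), the Fourier transform
`ξ̂(z) = ∫_0^1 ξ(x) e^{-izx} dx` (`z ∈ ℂ`) of the function `ξ(x) = Σ_{k ∈ S} ξ_k e^{2πikx}` on `[0, 1]`,
extended by `0` outside `[0, 1]`, has all its zeros on the real line. (Printed also: "`ξ̂` is entire" —
not asserted here.) Proof as printed: `∫_0^1 e^{2πikx} e^{-izx} dx = 2 e^{-iz/2} sin(z/2)/(z - 2πk)`, so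
off `2πS` one has `ξ̂(z) = (e^{-iz} - 1) Σ_k ξ_k /(i(2πk - z))`, whose zeros are `z ∈ 2πℤ` or roots of
`P(z/2π)`. [cite: ConnesSuijlekom2025, Theorem 5.6 (ii)] -/
theorem fourierIntegral_eq_zero_im_eq_zero (S : Finset ℤ) (hS : ∀ j ∈ S, -j ∈ S)
    {b ξ : S → ℝ} {Q : Matrix S S ℝ}
    (hb : ∀ i j : S, (i : ℤ) = -(j : ℤ) → b i = -b j)
    (hQoff : ∀ i j : S, i ≠ j → Q i j = (b i - b j) / (((i : ℤ) : ℝ) - ((j : ℤ) : ℝ)))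
    (hQ : Q.PosSemidef) (hξ0 : ξ ≠ 0) (hQξ : Q *ᵥ ξ = 0)
    (hker : ∀ v : S → ℝ, Q *ᵥ v = 0 → ∃ c : ℝ, v = c • ξ)
    (hξ : ∀ i j : S, (i : ℤ) = -(j : ℤ) → ξ i = ξ j)
    {z : ℂ}
    (hz : ∫ x in (0 : ℝ)..1, (∑ k : S, (ξ k : ℂ) * cexp (2 * π * I * ((k : ℤ) : ℂ) * (x : ℂ)))
      * cexp (-(I * z * (x : ℂ))) = 0) :
    z.im = 0 := by
  by_cases hex : ∃ k : S, z = 2 * π * ((k : ℤ) : ℂ)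
  · obtain ⟨k, rfl⟩ := hex
    have h : (2 * π * ((k : ℤ) : ℂ) : ℂ) = ((2 * π * (k : ℤ) : ℝ) : ℂ) := by push_cast; ring
    rw [h, Complex.ofReal_im]
  push Not at hex
  have hck : ∀ k : S, (2 * π * ((k : ℤ) : ℂ) - z) * I ≠ 0 := fun k =>
    mul_ne_zero (sub_ne_zero.mpr fun h => hex k h.symm) Complex.I_ne_zero
  -- the printed computation of `ξ̂(z)` off the lattice `2π S`
  have hint : ∫ x in (0 : ℝ)..1, (∑ k : S, (ξ k : ℂ) * cexp (2 * π * I * ((k : ℤ) : ℂ) * (x : ℂ)))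
        * cexp (-(I * z * (x : ℂ)))
      = (cexp (-(z * I)) - 1) * ∑ k : S, (ξ k : ℂ) / ((2 * π * ((k : ℤ) : ℂ) - z) * I) := by
    have h1 : ∀ x : ℝ, (∑ k : S, (ξ k : ℂ) * cexp (2 * π * I * ((k : ℤ) : ℂ) * (x : ℂ)))
          * cexp (-(I * z * (x : ℂ)))
        = ∑ k : S, (ξ k : ℂ) * cexp ((2 * π * ((k : ℤ) : ℂ) - z) * I * (x : ℂ)) := by
      intro x
      rw [sum_mul]
      refine sum_congr rfl fun k _ => ?_
      rw [mul_assoc, ← Complex.exp_add]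
      congr 2
      ring
    simp_rw [h1]
    rw [intervalIntegral.integral_finsetSum]
    · rw [mul_sum]
      refine sum_congr rfl fun k _ => ?_
      rw [intervalIntegral.integral_const_mul, integral_exp_mul_complex (hck k)]
      have e1 : cexp (2 * π * ((k : ℤ) : ℂ) * I) = 1 := by
        rw [← Complex.exp_int_mul_two_pi_mul_I (k : ℤ)]
        congr 1
        ring
      have e2 : cexp ((2 * π * ((k : ℤ) : ℂ) - z) * I * ((1 : ℝ) : ℂ)) = cexp (-(z * I)) := by
        rw [Complex.ofReal_one, mul_one, sub_mul, sub_eq_add_neg, Complex.exp_add, e1, one_mul]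
      rw [e2, Complex.ofReal_zero, mul_zero, Complex.exp_zero]
      ring
    · intro k _
      exact (continuous_const.mul (Complex.continuous_exp.comp
        (continuous_const.mul Complex.continuous_ofReal))).intervalIntegrable _ _
  rw [hint] at hz
  rcases mul_eq_zero.mp hz with h1 | h2
  · -- `e^{-iz} = 1`: `z ∈ 2πℤ` is real
    obtain ⟨n, hn⟩ := Complex.exp_eq_one_iff.mp (sub_eq_zero.mp h1)
    have h := congrArg Complex.re hn
    simpa using h
  · -- `Σ_k ξ_k/(2πk - z) = 0`: `z/2π` is a root of `P`
    have h2π : (2 * (π : ℂ)) ≠ 0 := by exact_mod_cast (Real.two_pi_pos).ne'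
    obtain ⟨μ, hz'⟩ : ∃ μ : ℂ, z = 2 * π * μ := ⟨z / (2 * π), by field_simp⟩
    have hkμ : ∀ k : S, ((k : ℤ) : ℂ) - μ ≠ 0 := by
      intro k h
      apply hex k
      rw [hz', ← sub_eq_zero.mp h]
    have hterm : ∀ k : S, (ξ k : ℂ) / ((2 * π * ((k : ℤ) : ℂ) - z) * I)
        = (1 / (2 * π * I)) * ((ξ k : ℂ) / (((k : ℤ) : ℂ) - μ)) := by
      intro k
      rw [hz']
      field_simp
    rw [sum_congr rfl fun k _ => hterm k, ← mul_sum, mul_eq_zero] at h2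
    rcases h2 with h3 | h3
    · exfalso
      simp [Real.pi_ne_zero, Complex.I_ne_zero] at h3
    · have hPμ : ∑ k : S, (ξ k : ℂ) * ∏ j ∈ univ.erase k, (((j : ℤ) : ℂ) - μ) = 0 := by
        have h : ∑ k : S, (ξ k : ℂ) * ∏ j ∈ univ.erase k, (((j : ℤ) : ℂ) - μ)
            = (∏ j : S, (((j : ℤ) : ℂ) - μ)) * ∑ k : S, (ξ k : ℂ) / (((k : ℤ) : ℂ) - μ) := by
          rw [mul_sum]
          refine sum_congr rfl fun k _ => ?_
          rw [← mul_prod_erase univ (fun j : S => (((j : ℤ) : ℂ) - μ)) (mem_univ k)]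
          field_simp [hkμ k]
        rw [h, h3, mul_zero]
      have him := im_eq_zero_of_even_kernel_int S hS hb hQoff hQ hξ0 hQξ hker hξ hPμ
      rw [hz']
      simp [him]

/-- **C–vS Theorem 5.6 (ii) on a window of length `L`** (the form used in Connes–Consani–Moscovici,
*Zeta spectral triples*, Thm. 5.10 (iii), with `L = 2 log λ` and the orthonormal basis
`U_n(x) = L^{-1/2} e^{2πinx/L}` of `L²([0, L])`, C–vS (4.2)): under the hypotheses of Theorem 5.6 (i),
every zero `z ∈ ℂ` of `∫_0^L (Σ_k ξ_k e^{2πikx/L}) e^{-izx} dx` is real. Reduction to `L = 1` by the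
substitution `x = L y` (`ξ̂_L(z) = L · ξ̂_1(zL)`). [cite: ConnesSuijlekom2025, Theorem 5.6 (ii) and eq. (4.2)] -/
theorem fourierIntegral_eq_zero_im_eq_zero_of_length (S : Finset ℤ) (hS : ∀ j ∈ S, -j ∈ S)
    {b ξ : S → ℝ} {Q : Matrix S S ℝ}
    (hb : ∀ i j : S, (i : ℤ) = -(j : ℤ) → b i = -b j)
    (hQoff : ∀ i j : S, i ≠ j → Q i j = (b i - b j) / (((i : ℤ) : ℝ) - ((j : ℤ) : ℝ)))
    (hQ : Q.PosSemidef) (hξ0 : ξ ≠ 0) (hQξ : Q *ᵥ ξ = 0)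
    (hker : ∀ v : S → ℝ, Q *ᵥ v = 0 → ∃ c : ℝ, v = c • ξ)
    (hξ : ∀ i j : S, (i : ℤ) = -(j : ℤ) → ξ i = ξ j)
    {L : ℝ} (hL : 0 < L) {z : ℂ}
    (hz : ∫ x in (0 : ℝ)..L, (∑ k : S, (ξ k : ℂ) * cexp (2 * π * I * ((k : ℤ) : ℂ) * (x : ℂ) / (L : ℂ)))
      * cexp (-(I * z * (x : ℂ))) = 0) :
    z.im = 0 := by
  have hL0 : (L : ℂ) ≠ 0 := by exact_mod_cast hL.ne'
  -- the integrand after the substitution `x = y L`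
  have hsub : (fun y : ℝ => (∑ k : S, (ξ k : ℂ) * cexp (2 * π * I * ((k : ℤ) : ℂ) * ((y * L : ℝ) : ℂ) / (L : ℂ)))
        * cexp (-(I * z * ((y * L : ℝ) : ℂ))))
      = fun y : ℝ => (∑ k : S, (ξ k : ℂ) * cexp (2 * π * I * ((k : ℤ) : ℂ) * (y : ℂ)))
        * cexp (-(I * (z * L) * (y : ℂ))) := by
    funext y
    congr 1
    · refine Finset.sum_congr rfl fun k _ => ?_
      congr 2
      push_cast
      field_simp
    · congr 1
      push_cast
      ring
  have h1 : ∫ y in (0 : ℝ)..1, (∑ k : S, (ξ k : ℂ) * cexp (2 * π * I * ((k : ℤ) : ℂ) * (y : ℂ)))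
      * cexp (-(I * (z * L) * (y : ℂ))) = 0 := by
    have h := intervalIntegral.integral_comp_mul_right
      (fun x : ℝ => (∑ k : S, (ξ k : ℂ) * cexp (2 * π * I * ((k : ℤ) : ℂ) * (x : ℂ) / (L : ℂ)))
        * cexp (-(I * z * (x : ℂ)))) (a := 0) (b := 1) hL.ne'
    rw [zero_mul, one_mul, hz, smul_zero, hsub] at h
    exact h
  have him := fourierIntegral_eq_zero_im_eq_zero S hS hb hQoff hQ hξ0 hQξ hker hξ h1
  rw [mul_im, ofReal_re, ofReal_im, mul_zero, zero_add] at him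
  exact (mul_eq_zero.mp him).resolve_right hL.ne'

/-! ## Lemma 5.3 / 5.9 as printed: the determinant of `D' - s` -/

/-- The matrix of `D' = D - |Dξ⟩⟨η|` shifted by `t`: `((D' - t) v)_i = (λ_i - t) v_i - λ_i ξ_i Σ_l v_l`.
[cite: ConnesSuijlekom2025, Lemma 5.2 (definition of D') and Lemma 5.3] -/
theorem dPrimeMatrix_sub_mulVec {K : Type*} [Field K] [DecidableEq ι] (lam ξ : ι → K) (t : K)
    (v : ι → K) (i : ι) :
    ((Matrix.diagonal lam - Matrix.vecMulVec (fun k => lam k * ξ k) (fun _ => (1 : K))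
        - t • (1 : Matrix ι ι K)) *ᵥ v) i = (lam i - t) * v i - lam i * ξ i * ∑ l, v l := by
  simp only [Matrix.sub_mulVec, Matrix.smul_mulVec, Matrix.one_mulVec, Matrix.mulVec_diagonal,
    Pi.sub_apply, Pi.smul_apply, smul_eq_mul]
  simp only [Matrix.mulVec, dotProduct, Matrix.vecMulVec_apply, mul_one, ← Finset.mul_sum]
  ring

/-- **C–vS Lemma 5.3, eq. (5.5)** (and (5.10) for general simple spectrum): for `s` off the spectrum of
`D` and `⟨η ∣ ξ⟩ = 1`,
`Det(D' - s) = -s · Det(D - s) · ⟨η ∣ (D - s)⁻¹ ξ⟩ = -s Π_i (λ_i - s) Σ_j ξ_j/(λ_j - s)`,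
where `D' = D - |Dξ⟩⟨η|` has matrix `λ_i δ_{ij} - λ_i ξ_i`. Proof as printed (matrix determinant lemma
for the rank-one perturbation of `D - s`). [cite: ConnesSuijlekom2025, Lemma 5.3, eq. (5.5)] -/
theorem det_dPrimeMatrix_sub {K : Type*} [Field K] [DecidableEq ι] {lam ξ : ι → K}
    (hηξ : ∑ j, ξ j = 1) {s : K} (hs : ∀ j, lam j - s ≠ 0) :
    (Matrix.diagonal lam - Matrix.vecMulVec (fun k => lam k * ξ k) (fun _ => (1 : K))
        - s • (1 : Matrix ι ι K)).det
      = -s * (∏ i, (lam i - s)) * ∑ j, ξ j / (lam j - s) := by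
  -- `D' - s = (D - s) + |(-Dξ)⟩⟨η|`
  have hA : Matrix.diagonal lam - Matrix.vecMulVec (fun k => lam k * ξ k) (fun _ => (1 : K))
        - s • (1 : Matrix ι ι K)
      = Matrix.diagonal (fun i => lam i - s)
        + Matrix.replicateCol Unit (fun k => -(lam k * ξ k)) * Matrix.replicateRow Unit (fun _ => (1 : K)) := by
    rw [← Matrix.vecMulVec_eq Unit]
    ext i j
    simp only [Matrix.sub_apply, Matrix.add_apply, Matrix.smul_apply, Matrix.diagonal_apply,
      Matrix.vecMulVec_apply, Matrix.one_apply, smul_eq_mul]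
    split_ifs <;> ring
  have hdet : (Matrix.diagonal fun i => lam i - s).det = ∏ i, (lam i - s) := Matrix.det_diagonal
  have hunit : IsUnit (Matrix.diagonal fun i => lam i - s).det := by
    rw [hdet]
    exact isUnit_iff_ne_zero.mpr (prod_ne_zero_iff.mpr fun j _ => hs j)
  have hinv : (Matrix.diagonal fun i => lam i - s)⁻¹ = Matrix.diagonal fun i => (lam i - s)⁻¹ := by
    apply Matrix.inv_eq_right_inv
    rw [Matrix.diagonal_mul_diagonal, ← Matrix.diagonal_one]
    congr 1
    funext i
    exact mul_inv_cancel₀ (hs i)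
  rw [hA, Matrix.det_add_mul _ _ hunit, hdet, Matrix.det_unique, hinv, Matrix.add_apply,
    Matrix.one_apply_eq, Matrix.mul_apply]
  simp only [Matrix.mul_diagonal, Matrix.replicateRow_apply, Matrix.replicateCol_apply]
  have hterm : ∀ j, (1 : K) * (lam j - s)⁻¹ * -(lam j * ξ j) = -ξ j - s * (ξ j / (lam j - s)) := by
    intro j
    field_simp [hs j]
    ring
  rw [Finset.sum_congr rfl fun j _ => hterm j, sum_sub_distrib, sum_neg_distrib, hηξ, ← mul_sum]
  ring

/-- **C–vS Lemma 5.3 (i) / 5.9 (i).** For `s ∉ {λ_j}`, `s ≠ 0` (and `⟨η ∣ ξ⟩ = 1`):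
`Det(D' - s) = 0 ⟺ Σ_j ξ_j/(s - λ_j) = 0`. [cite: ConnesSuijlekom2025, Lemma 5.3 (i)] -/
theorem det_dPrimeMatrix_sub_eq_zero_iff {K : Type*} [Field K] [DecidableEq ι] {lam ξ : ι → K}
    (hηξ : ∑ j, ξ j = 1) {s : K} (hs : ∀ j, lam j - s ≠ 0) (hs0 : s ≠ 0) :
    (Matrix.diagonal lam - Matrix.vecMulVec (fun k => lam k * ξ k) (fun _ => (1 : K))
        - s • (1 : Matrix ι ι K)).det = 0 ↔ ∑ j, ξ j / (s - lam j) = 0 := by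
  rw [det_dPrimeMatrix_sub hηξ hs]
  have hp : ∏ i, (lam i - s) ≠ 0 := prod_ne_zero_iff.mpr fun j _ => hs j
  have hS : ∑ j, ξ j / (s - lam j) = -∑ j, ξ j / (lam j - s) := by
    rw [← sum_neg_distrib]
    refine sum_congr rfl fun j _ => ?_
    rw [← div_neg, neg_sub]
  rw [hS, neg_eq_zero]
  constructor
  · intro h
    rcases mul_eq_zero.mp h with h1 | h1
    · rcases mul_eq_zero.mp h1 with h2 | h2
      · exact absurd (neg_eq_zero.mp h2) hs0
      · exact absurd h2 hp
    · exact h1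
  · intro h
    rw [h, mul_zero]

/-- **C–vS Lemma 5.3 (ii), first part:** `Det(D') = 0` (indeed `D' ξ = 0`), given `⟨η ∣ ξ⟩ = 1`.
[cite: ConnesSuijlekom2025, Lemma 5.3 (ii)] -/
theorem det_dPrimeMatrix_eq_zero {K : Type*} [Field K] [DecidableEq ι] {lam ξ : ι → K}
    (hηξ : ∑ j, ξ j = 1) :
    (Matrix.diagonal lam - Matrix.vecMulVec (fun k => lam k * ξ k) (fun _ => (1 : K))).det = 0 := by
  rw [← sub_zero (Matrix.diagonal lam - Matrix.vecMulVec (fun k => lam k * ξ k) (fun _ => (1 : K))),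
    ← zero_smul K (1 : Matrix ι ι K)]
  apply Matrix.exists_mulVec_eq_zero_iff.mp
  refine ⟨ξ, ?_, ?_⟩
  · intro h
    rw [h] at hηξ
    simp at hηξ
  · funext i
    rw [dPrimeMatrix_sub_mulVec, hηξ, Pi.zero_apply]
    ring

/-- **C–vS Lemma 5.3 (ii), second part / 5.9 (ii):** for `λ_j ≠ 0` (simple spectrum),
`Det(D' - λ_j) = 0 ⟺ ξ_j = 0`. (Printed via (5.5) at `s = λ_j`; here via an explicit eigenvector, which
does not need the normalisation `⟨η ∣ ξ⟩ = 1`.)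
[cite: ConnesSuijlekom2025, Lemma 5.3 (ii) and Lemma 5.9 (ii)] -/
theorem det_dPrimeMatrix_sub_eigenvalue_eq_zero_iff {K : Type*} [Field K] [DecidableEq ι]
    {lam ξ : ι → K} (hlam : Function.Injective lam) {j : ι} (hj : lam j ≠ 0) :
    (Matrix.diagonal lam - Matrix.vecMulVec (fun k => lam k * ξ k) (fun _ => (1 : K))
        - lam j • (1 : Matrix ι ι K)).det = 0 ↔ ξ j = 0 := by
  rw [← Matrix.exists_mulVec_eq_zero_iff]
  constructor
  · rintro ⟨v, hv0, hv⟩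
    have he : ∀ i, (lam i - lam j) * v i = lam i * ξ i * ∑ l, v l := fun i => by
      have h := congr_fun hv i
      rw [dPrimeMatrix_sub_mulVec, Pi.zero_apply] at h
      exact sub_eq_zero.mp h
    by_contra hξj
    have hc : ∑ l, v l = 0 := by
      have h := he j
      rw [sub_self, zero_mul] at h
      rcases mul_eq_zero.mp h.symm with h1 | h1
      · exact absurd ((mul_eq_zero.mp h1).resolve_left hj) hξj
      · exact h1
    have hvi : ∀ i, i ≠ j → v i = 0 := fun i hi => by
      have h := he i
      rw [hc, mul_zero] at h
      exact (mul_eq_zero.mp h).resolve_left (sub_ne_zero.mpr (hlam.ne hi))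
    have hvj : v j = 0 := by
      have h : ∑ l, v l = v j := by
        rw [sum_eq_single j (fun i _ hi => hvi i hi) (fun h => absurd (mem_univ j) h)]
      rw [← h, hc]
    exact hv0 (funext fun i => by
      by_cases hi : i = j
      · rw [hi]; exact hvj
      · exact hvi i hi)
  · intro hξj
    -- the explicit eigenvector `v_i = λ_i ξ_i/(λ_i - λ_j)` (`i ≠ j`), `v_j = 1 - Σ_{i ≠ j} v_i`
    refine ⟨fun i => if i = j then 1 - ∑ l ∈ univ.erase j, lam l * ξ l / (lam l - lam j)
      else lam i * ξ i / (lam i - lam j), ?_, ?_⟩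
    · intro h0
      have hoff : ∀ i, i ≠ j → lam i * ξ i / (lam i - lam j) = 0 := fun i hi => by
        have h := congr_fun h0 i
        rw [Pi.zero_apply, if_neg hi] at h
        exact h
      have hvj := congr_fun h0 j
      rw [Pi.zero_apply, if_pos rfl,
        sum_eq_zero (fun l hl => hoff l (ne_of_mem_erase hl)), sub_zero] at hvj
      exact one_ne_zero hvj
    · have hsum : ∑ l, (if l = j then 1 - ∑ l ∈ univ.erase j, lam l * ξ l / (lam l - lam j)
          else lam l * ξ l / (lam l - lam j)) = 1 := by
        rw [← add_sum_erase univ _ (mem_univ j), if_pos rfl,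
          sum_congr rfl fun l hl => if_neg (ne_of_mem_erase hl)]
        ring
      funext i
      rw [dPrimeMatrix_sub_mulVec, hsum, Pi.zero_apply, mul_one]
      by_cases hi : i = j
      · subst hi
        rw [if_pos rfl, hξj, sub_self, zero_mul, mul_zero, sub_zero]
      · rw [if_neg hi, mul_div_cancel₀ _ (sub_ne_zero.mpr (hlam.ne hi)), sub_self]

end ConnesVanSuijlekom

end Literature.LinearAlgebra.Matrix
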